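import Summits.ValiantsHypothesis.ValiantsHypothesis.Theorems.DivisionGapZeroOneTransferStubFormulaGridProjectionAux1

/-!
# Crux `DivisionGap.ZeroOneTransfer` (stmt-ValiantsHypothesis-5066), line `planar-dimer-sign-elimination` —
stub `stub_formulaGridProjection`, support file 2: the two-state gadget calculus

A TWO-STATE GADGET (`TwoState⟦D, W, p, q, g⟧`, a local notation for a six-fold conjunction) is a vertex
set `D` with two ports `p ≠ q` whose matching sum (file 1, `msum`) is `g` when both ports are matched
inside ("active"), `1` when both are removed ("inactive"), and whose size is even (so a single
removed port leaves matching sum `0`).  This is the two-attachment case of a gadget signature and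
exactly what the series–parallel translation of an arithmetic formula into perfect matchings needs
(Valiant 1979 §2; the in/out vertex splitting of Datta–Kulkarni–Limaye–Mahajan 2010 §4.4 keeps the
graphs bipartite):

* `twoState_pair` — the leaf, one edge; `twoState_path` — unit wires (paths of even order);
* `msum_oneConn`, `twoState_series` — one unit connector edge: SERIES composition multiplies;
* `msum_attach` — a two-state gadget hanging off the rest through two unit connector edges can be
  traded for its two states (the engine of PARALLEL composition, file 3);
* `twoState_filler` — adding a disjoint forced domino tiling of unit weight changes nothing.

Registered sub-goal proved here: `stub_formulaGridProjection_oneConnector` (the one-connector cut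
lemma in closed form).  Everything over an arbitrary commutative semiring. [folklore]
-/

set_option linter.dupNamespace false

namespace Summit.ValiantsHypothesis.ValiantsHypothesis.Theorems.DivisionGapZeroOneTransfer

namespace FormulaGridProjection

open Finset

section TwoStateCalculus

variable {α : Type*} [DecidableEq α] {S : Type*} [CommSemiring S]

/-- `TwoState⟦D, W, p, q, g⟧` (a LOCAL NOTATION, deliberately not a definition): a TWO-STATE GADGET on the
vertex set `D` with ports `p ≠ q` computing `g` — the whole of `D` has matching sum `g` ("active": both
ports matched inside), `D ∖ {p, q}` has matching sum `1` ("inactive"), and `|D|` is even (so the two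
mixed states have matching sum `0` by parity).  The two-attachment case of a gadget signature
(Valiant 1979 §2; DKLM 2010 §4.4). -/
local notation3 "TwoState⟦" D ", " W ", " p ", " q ", " g "⟧" =>
  p ∈ D ∧ q ∈ D ∧ p ≠ q ∧ Even (Finset.card D) ∧ msum D W = g ∧
    msum (Finset.erase (Finset.erase D p) q) W = 1

/-- Being two-state only depends on the weights of darts inside `D`. [folklore] -/
theorem twoState_congr {D : Finset α} {W W' : α → α → S} {p q : α} {g : S}
    (h : ∀ a ∈ D, ∀ b ∈ D, W a b = W' a b) (hT : TwoState⟦D, W, p, q, g⟧) : TwoState⟦D, W', p, q, g⟧ := by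
  obtain ⟨hp, hq, hpq, hev, hact, hin⟩ := hT
  refine ⟨hp, hq, hpq, hev, ?_, ?_⟩
  · rw [← msum_congr h, hact]
  · rw [← msum_congr fun a ha b hb => h a (mem_of_mem_erase (mem_of_mem_erase ha)) b
      (mem_of_mem_erase (mem_of_mem_erase hb)), hin]

/-- The LEAF: one edge `p — q` with `W p q * W q p = g`. [folklore] -/
theorem twoState_pair (W : α → α → S) {p q : α} (hpq : p ≠ q) {g : S}
    (hg : W p q * W q p = g) : TwoState⟦({p, q} : Finset α), W, p, q, g⟧ := by
  refine ⟨mem_insert_self _ _, mem_insert_of_mem (mem_singleton_self _), hpq, ?_, ?_, ?_⟩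
  · rw [card_pair hpq]; exact even_two
  · rw [msum_pair W hpq, hg]
  · rw [erase_insert (by simpa using hpq), erase_singleton, msum_empty]

/-- Removing a vertex from an even vertex set leaves an odd one. [folklore] -/
theorem odd_card_erase {D : Finset α} {x : α} (hx : x ∈ D) (h : Even D.card) :
    Odd (D.erase x).card := by
  rw [card_erase_of_mem hx]
  have : 0 < D.card := card_pos.2 ⟨x, hx⟩
  rcases h with ⟨k, hk⟩
  exact ⟨k - 1, by omega⟩

/-- **One connector.** If the only dart of non-zero weight from `D₁` to the disjoint `D₂` is
`a → b`, then `msum (D₁ ∪ D₂) = msum D₁ * msum D₂ + W a b * W b a * msum (D₁ ∖ a) * msum (D₂ ∖ b)`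
(the connector is unused or used). [folklore] -/
theorem msum_oneConn {D₁ D₂ : Finset α} (W : α → α → S) (hd : Disjoint D₁ D₂) {a b : α}
    (ha : a ∈ D₁) (hb : b ∈ D₂) (h0 : ∀ x ∈ D₁, ∀ y ∈ D₂, W x y ≠ 0 → x = a ∧ y = b) :
    msum (D₁ ∪ D₂) W = msum D₁ W * msum D₂ W +
      W a b * W b a * (msum (D₁.erase a) W * msum (D₂.erase b) W) := by
  have hbD₁ : b ∉ D₁ := fun h => disjoint_left.1 hd h hb
  have haD₂ : a ∉ D₂ := disjoint_left.1 hd ha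
  rw [msum_expand (D₁ ∪ D₂) W (mem_union_left _ ha), msum_expand D₁ W ha,
    show (D₁ ∪ D₂).erase a = D₁.erase a ∪ D₂ by rw [erase_union_distrib, erase_eq_of_notMem haD₂],
    sum_union (disjoint_of_subset_left (erase_subset _ _) hd), sum_mul]
  congr 1
  · refine sum_congr rfl fun u hu => ?_
    have hu1 : u ∈ D₁ := mem_of_mem_erase hu
    rw [show (D₁.erase a ∪ D₂).erase u = (D₁.erase a).erase u ∪ D₂ by
        rw [erase_union_distrib, erase_eq_of_notMem (s := D₂) (disjoint_left.1 hd hu1)],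
      msum_union W (disjoint_of_subset_left ((erase_subset _ _).trans (erase_subset _ _)) hd) ?_]
    · ring
    · intro x hx y hy
      by_contra hne
      exact ne_of_mem_erase (mem_of_mem_erase hx)
        (h0 x (mem_of_mem_erase (mem_of_mem_erase hx)) y hy hne).1
  · rw [sum_eq_single_of_mem b hb fun u hu hub => ?_]
    · rw [show (D₁.erase a ∪ D₂).erase b = D₁.erase a ∪ D₂.erase b by
          rw [erase_union_distrib, erase_eq_of_notMem (s := D₁.erase a)
            (fun h => hbD₁ (mem_of_mem_erase h))],
        msum_union W (disjoint_of_subset_left (erase_subset _ _)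
          (disjoint_of_subset_right (erase_subset _ _) hd)) ?_]
      intro x hx y hy
      by_contra hne
      exact ne_of_mem_erase hx (h0 x (mem_of_mem_erase hx) y (mem_of_mem_erase hy) hne).1
    · have : W a u = 0 := by
        by_contra hne
        exact hub (h0 a ha u hu hne).2
      rw [this, zero_mul, zero_mul]

/-- **Series composition.** Two two-state gadgets joined by one connector edge `q₁ — p₂` of unit
weight form a two-state gadget with ports `p₁`, `q₂` computing the product (active: connector
unused, `g₁ g₂`; inactive: connector used, `1 · 1`; parity kills the mixed terms). [folklore] -/
theorem twoState_series {D₁ D₂ : Finset α} {W : α → α → S} {p₁ q₁ p₂ q₂ : α} {g₁ g₂ : S}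
    (h₁ : TwoState⟦D₁, W, p₁, q₁, g₁⟧) (h₂ : TwoState⟦D₂, W, p₂, q₂, g₂⟧) (hd : Disjoint D₁ D₂)
    (h0 : ∀ x ∈ D₁, ∀ y ∈ D₂, W x y ≠ 0 → x = q₁ ∧ y = p₂) (hc : W q₁ p₂ * W p₂ q₁ = 1) :
    TwoState⟦(D₁ ∪ D₂), W, p₁, q₂, (g₁ * g₂)⟧ := by
  obtain ⟨hp₁, hq₁, hpq₁, hev₁, hact₁, hin₁⟩ := h₁
  obtain ⟨hp₂, hq₂, hpq₂, hev₂, hact₂, hin₂⟩ := h₂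
  have hp₁D₂ : p₁ ∉ D₂ := disjoint_left.1 hd hp₁
  have hq₂D₁ : q₂ ∉ D₁ := fun h => disjoint_left.1 hd h hq₂
  refine ⟨mem_union_left _ hp₁, mem_union_right _ hq₂, fun h => hp₁D₂ (h ▸ hq₂), ?_, ?_, ?_⟩
  · rw [card_union_of_disjoint hd]; exact hev₁.add hev₂
  · rw [msum_oneConn W hd hq₁ hp₂ h0, hact₁, hact₂,
      msum_eq_zero_of_odd_card W (odd_card_erase hq₁ hev₁), zero_mul, mul_zero, add_zero]
  · have hset : ((D₁ ∪ D₂).erase p₁).erase q₂ = D₁.erase p₁ ∪ D₂.erase q₂ := by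
      rw [erase_union_distrib, erase_union_distrib, erase_eq_of_notMem hp₁D₂,
        erase_eq_of_notMem (s := D₁.erase p₁) (fun h => hq₂D₁ (mem_of_mem_erase h))]
    rw [hset, msum_oneConn W (disjoint_of_subset_left (erase_subset _ _)
        (disjoint_of_subset_right (erase_subset _ _) hd)) (mem_erase.2 ⟨hpq₁.symm, hq₁⟩)
        (mem_erase.2 ⟨hpq₂, hp₂⟩)
        (fun x hx y hy hne => h0 x (mem_of_mem_erase hx) y (mem_of_mem_erase hy) hne),
      msum_eq_zero_of_odd_card W (odd_card_erase hp₁ hev₁), zero_mul, zero_add, hc, one_mul, hin₁,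
      one_mul, erase_right_comm, hin₂]

/-- **Attaching a two-state gadget through two vertices.** A two-state gadget `D` (ports `P`, `Q`,
value `g`) whose only connections to the disjoint rest `R` are unit edges `P — x`, `Q — y` can be
traded for its two states: `msum (D ∪ R) = g * msum R + msum (R ∖ {x, y})`. [folklore] -/
theorem msum_attach {D R : Finset α} {W : α → α → S} {P Q : α} {g : S} (hT : TwoState⟦D, W, P, Q, g⟧)
    (hd : Disjoint D R) {x y : α} (hx : x ∈ R) (hy : y ∈ R) (hxy : x ≠ y)
    (h0 : ∀ u ∈ D, ∀ v ∈ R, W u v ≠ 0 → (u = P ∧ v = x) ∨ (u = Q ∧ v = y))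
    (h0' : ∀ v ∈ R, ∀ u ∈ D, W v u ≠ 0 → (v = x ∧ u = P) ∨ (v = y ∧ u = Q))
    (hPx : W P x * W x P = 1) (hQy : W Q y * W y Q = 1) :
    msum (D ∪ R) W = g * msum R W + msum ((R.erase x).erase y) W := by
  obtain ⟨hP, hQ, hPQ, hev, hact, hin⟩ := hT
  have hxD : x ∉ D := fun h => disjoint_left.1 hd h hx
  have hPR : P ∉ R := disjoint_left.1 hd hP
  rw [msum_expand (D ∪ R) W (mem_union_right _ hx),
    show (D ∪ R).erase x = D ∪ R.erase x by rw [erase_union_distrib, erase_eq_of_notMem hxD],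
    sum_union (disjoint_of_subset_right (erase_subset _ _) hd)]
  -- the partner of `x` inside the gadget can only be `P`; then `Q` is forced onto `y`
  have hA : ∑ u ∈ D, W x u * W u x * msum ((D ∪ R.erase x).erase u) W =
      msum ((R.erase x).erase y) W := by
    rw [sum_eq_single_of_mem P hP fun u hu huP => ?_]
    · rw [mul_comm (W x P), hPx, one_mul,
        show (D ∪ R.erase x).erase P = D.erase P ∪ R.erase x by
          rw [erase_union_distrib, erase_eq_of_notMem (s := R.erase x)
            (fun h => hPR (mem_of_mem_erase h))],
        msum_oneConn W (disjoint_of_subset_left (erase_subset _ _)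
          (disjoint_of_subset_right (erase_subset _ _) hd))
          (mem_erase.2 ⟨hPQ.symm, hQ⟩) (mem_erase.2 ⟨hxy.symm, hy⟩) ?_,
        msum_eq_zero_of_odd_card W (odd_card_erase hP hev), zero_mul, zero_add, hQy, one_mul, hin,
        one_mul]
      intro u hu v hv hne
      rcases h0 u (mem_of_mem_erase hu) v (mem_of_mem_erase hv) hne with ⟨h, -⟩ | h
      · exact absurd h (ne_of_mem_erase hu)
      · exact h
    · have : W x u = 0 := by
        by_contra hne
        rcases h0' x hx u hu hne with ⟨-, h⟩ | ⟨h, -⟩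
        · exact huP h
        · exact hxy h
      rw [this, zero_mul, zero_mul]
  -- any other partner `u ∈ R` of `x` leaves the gadget attached through `Q — y` only
  have hB : ∀ u ∈ R.erase x, msum ((D ∪ R.erase x).erase u) W = g * msum ((R.erase x).erase u) W := by
    intro u hu
    rw [show (D ∪ R.erase x).erase u = D ∪ (R.erase x).erase u by
        rw [erase_union_distrib, erase_eq_of_notMem (s := D)
          (fun h => (disjoint_left.1 hd h) (mem_of_mem_erase hu))]]
    by_cases huy : u = y
    · subst huy
      rw [msum_union W (disjoint_of_subset_right ((erase_subset _ _).trans (erase_subset _ _)) hd)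
          ?_, hact]
      intro a ha b hb
      by_contra hne
      rcases h0 a ha b (mem_of_mem_erase (mem_of_mem_erase hb)) hne with ⟨-, h⟩ | ⟨-, h⟩
      · exact ne_of_mem_erase (mem_of_mem_erase hb) h
      · exact ne_of_mem_erase hb h
    · rw [msum_oneConn W (disjoint_of_subset_right ((erase_subset _ _).trans (erase_subset _ _)) hd)
          hQ (mem_erase.2 ⟨Ne.symm huy, mem_erase.2 ⟨hxy.symm, hy⟩⟩) ?_, hact,
        msum_eq_zero_of_odd_card W (odd_card_erase hQ hev), zero_mul, mul_zero, add_zero]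
      intro a ha b hb hne
      rcases h0 a ha b (mem_of_mem_erase (mem_of_mem_erase hb)) hne with ⟨-, h⟩ | h
      · exact absurd h (ne_of_mem_erase (mem_of_mem_erase hb))
      · exact h
  rw [hA, sum_congr rfl fun u hu => by rw [hB u hu], msum_expand R W hx, mul_sum, add_comm]
  congr 1
  exact sum_congr rfl fun u _ => by ring

/-- **Fillers.** Adding to a two-state gadget a disjoint vertex set `P` that carries a forced
perfect matching `τ` of unit weight, with no dart of non-zero weight from the gadget into `P`,
keeps it two-state with the same ports and value. [folklore] -/
theorem twoState_filler {D P : Finset α} {W W' : α → α → S} {p q : α} {g : S}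
    (hT : TwoState⟦D, W, p, q, g⟧) (hd : Disjoint D P) (τ : α → α)
    (hτ : ∀ a ∈ P, τ a ∈ P ∧ τ a ≠ a ∧ τ (τ a) = a)
    (hW'D : ∀ a ∈ D, ∀ b ∈ D, W' a b = W a b) (hcross : ∀ a ∈ D, ∀ b ∈ P, W' a b = 0)
    (hP0 : ∀ a ∈ P, ∀ b ∈ P, b ≠ a → b ≠ τ a → W' a b = 0) (hP1 : ∀ a ∈ P, W' a (τ a) = 1) :
    TwoState⟦(D ∪ P), W', p, q, g⟧ := by
  obtain ⟨hp, hq, hpq, hev, hact, hin⟩ := twoState_congr (fun a ha b hb => (hW'D a ha b hb).symm) hT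
  obtain ⟨hP, hPev⟩ := msum_perfect W' τ hτ hP0 hP1
  have hpP : p ∉ P := disjoint_left.1 hd hp
  have hqP : q ∉ P := disjoint_left.1 hd hq
  refine ⟨mem_union_left _ hp, mem_union_left _ hq, hpq, ?_, ?_, ?_⟩
  · rw [card_union_of_disjoint hd]; exact hev.add hPev
  · rw [msum_union W' hd hcross, hact, hP, mul_one]
  · rw [show ((D ∪ P).erase p).erase q = (D.erase p).erase q ∪ P by
        rw [erase_union_distrib, erase_union_distrib, erase_eq_of_notMem hpP, erase_eq_of_notMem hqP],
      msum_union W' (disjoint_of_subset_left ((erase_subset _ _).trans (erase_subset _ _)) hd)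
        (fun a ha b hb => hcross a (mem_of_mem_erase (mem_of_mem_erase ha)) b hb), hin, hP, mul_one]



/-- The two ports play symmetric roles. [folklore] -/
theorem twoState_swap {D : Finset α} {W : α → α → S} {p q : α} {g : S}
    (hT : TwoState⟦D, W, p, q, g⟧) : TwoState⟦D, W, q, p, g⟧ := by
  obtain ⟨hp, hq, hpq, hev, hact, hin⟩ := hT
  exact ⟨hq, hp, hpq.symm, hev, hact, by rw [erase_right_comm, hin]⟩

/-- Rewriting the value of a two-state gadget. [folklore] -/
theorem twoState_of_eq {D : Finset α} {W : α → α → S} {p q : α} {g g' : S}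
    (hT : TwoState⟦D, W, p, q, g⟧) (h : g = g') : TwoState⟦D, W, p, q, g'⟧ := h ▸ hT

/-- **Paths (wires).** A path `v 0 — v 1 — ⋯ — v (2k+1)` on an even number of distinct vertices whose
first edge has weight `ℓ`, whose other edges have unit weight and which carries no other dart of
non-zero weight is a two-state gadget with the two ends as ports computing `ℓ` (iterated series
composition of single edges; with `ℓ = 1` these are the unit wires of the grid layout). [folklore] -/
theorem twoState_path {W : α → α → S} (v : ℕ → α) {ℓ : S} :
    ∀ k : ℕ, (∀ i < 2 * k + 2, ∀ j < 2 * k + 2, v i = v j → i = j) →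
      W (v 0) (v 1) * W (v 1) (v 0) = ℓ →
      (∀ i, 1 ≤ i → i < 2 * k + 1 → W (v i) (v (i + 1)) * W (v (i + 1)) (v i) = 1) →
      (∀ i < 2 * k + 2, ∀ j < 2 * k + 2, W (v i) (v j) ≠ 0 → i + 1 = j ∨ j + 1 = i) →
      TwoState⟦(Finset.range (2 * k + 2)).image v, W, v 0, v (2 * k + 1), ℓ⟧ := by
  intro k
  induction k with
  | zero =>
    intro hinj hℓ _ _
    have h01 : v 0 ≠ v 1 := fun h => absurd (hinj 0 (by omega) 1 (by omega) h) (by omega)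
    have hset : (Finset.range (2 * 0 + 2)).image v = {v 0, v 1} := by
      rw [show 2 * 0 + 2 = 1 + 1 from rfl, Finset.range_add_one, Finset.image_insert, Finset.range_one,
        Finset.image_singleton, Finset.pair_comm]
    rw [hset]
    exact twoState_pair W h01 hℓ
  | succ k ih =>
    intro hinj hℓ hunit hzero
    have ih' := ih (fun i hi j hj h => hinj i (by omega) j (by omega) h) hℓ
      (fun i h1 h2 => hunit i h1 (by omega)) (fun i hi j hj h => hzero i (by omega) j (by omega) h)
    have hne : v (2 * k + 2) ≠ v (2 * k + 3) := fun h =>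
      absurd (hinj _ (by omega) _ (by omega) h) (by omega)
    have hpair := twoState_pair W hne (hunit (2 * k + 2) (by omega) (by omega))
    have hset : (Finset.range (2 * (k + 1) + 2)).image v =
        (Finset.range (2 * k + 2)).image v ∪ {v (2 * k + 2), v (2 * k + 3)} := by
      ext x
      simp only [Finset.mem_image, Finset.mem_range, Finset.mem_union, Finset.mem_insert,
        Finset.mem_singleton]
      constructor
      · rintro ⟨i, hi, rfl⟩
        by_cases h : i < 2 * k + 2
        · exact Or.inl ⟨i, h, rfl⟩
        · rcases (show i = 2 * k + 2 ∨ i = 2 * k + 3 by omega) with rfl | rfl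
          · exact Or.inr (Or.inl rfl)
          · exact Or.inr (Or.inr rfl)
      · rintro (⟨i, hi, rfl⟩ | rfl | rfl)
        · exact ⟨i, by omega, rfl⟩
        · exact ⟨2 * k + 2, by omega, rfl⟩
        · exact ⟨2 * k + 3, by omega, rfl⟩
    have hdisj : Disjoint ((Finset.range (2 * k + 2)).image v) {v (2 * k + 2), v (2 * k + 3)} := by
      rw [Finset.disjoint_left]
      intro x hx hx'
      simp only [Finset.mem_image, Finset.mem_range] at hx
      obtain ⟨i, hi, rfl⟩ := hx
      simp only [Finset.mem_insert, Finset.mem_singleton] at hx'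
      rcases hx' with h | h
      · exact absurd (hinj i (by omega) _ (by omega) h) (by omega)
      · exact absurd (hinj i (by omega) _ (by omega) h) (by omega)
    rw [hset, show 2 * (k + 1) + 1 = 2 * k + 3 by ring]
    refine twoState_of_eq (twoState_series ih' hpair hdisj ?_ (hunit (2 * k + 1) (by omega) (by omega)))
      (mul_one ℓ)
    intro x hx y hy hne0
    simp only [Finset.mem_image, Finset.mem_range] at hx
    obtain ⟨i, hi, rfl⟩ := hx
    simp only [Finset.mem_insert, Finset.mem_singleton] at hy
    rcases hy with rfl | rfl
    · rcases hzero i (by omega) (2 * k + 2) (by omega) hne0 with h | h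
      · rw [show i = 2 * k + 1 by omega]; exact ⟨rfl, rfl⟩
      · omega
    · rcases hzero i (by omega) (2 * k + 3) (by omega) hne0 with h | h <;> omega

end TwoStateCalculus

end FormulaGridProjection

open Finset FormulaGridProjection in
/-- **Registered sub-goal `stub_formulaGridProjection_oneConnector`** of `stub_formulaGridProjection`
(crux stmt-ValiantsHypothesis-5066, line `planar-dimer-sign-elimination`): the ONE-CONNECTOR CUT
LEMMA of the gadget calculus — if the only dart of non-zero weight from `D₁` into the disjoint `D₂`
is `a → b`, the matching sum of `D₁ ∪ D₂` is `msum D₁ * msum D₂` (connector unused) plus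
`W a b * W b a * msum (D₁ ∖ a) * msum (D₂ ∖ b)` (connector used). [folklore] -/
theorem stub_formulaGridProjection_oneConnector : ∀ (α : Type) [DecidableEq α] (S : Type) [CommSemiring S] (D₁ D₂ : Finset α) (W : α → α → S) (a b : α), Disjoint D₁ D₂ → a ∈ D₁ → b ∈ D₂ → (∀ x ∈ D₁, ∀ y ∈ D₂, W x y ≠ 0 → x = a ∧ y = b) → Summit.ValiantsHypothesis.ValiantsHypothesis.Theorems.DivisionGapZeroOneTransfer.FormulaGridProjection.msum (D₁ ∪ D₂) W = Summit.ValiantsHypothesis.ValiantsHypothesis.Theorems.DivisionGapZeroOneTransfer.FormulaGridProjection.msum D₁ W * Summit.ValiantsHypothesis.ValiantsHypothesis.Theorems.DivisionGapZeroOneTransfer.FormulaGridProjection.msum D₂ W + W a b * W b a * (Summit.ValiantsHypothesis.ValiantsHypothesis.Theorems.DivisionGapZeroOneTransfer.FormulaGridProjection.msum (D₁.erase a) W * Summit.ValiantsHypothesis.ValiantsHypothesis.Theorems.DivisionGapZeroOneTransfer.FormulaGridProjection.msum (D₂.erase b) W) :=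
  fun _ _ _ _ _ _ W _ _ hd ha hb h0 => msum_oneConn W hd ha hb h0

end Summit.ValiantsHypothesis.ValiantsHypothesis.Theorems.DivisionGapZeroOneTransfer
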